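import Mathlib
import HarnessLib
import Summits.Ventures.LatticeQCDFlow.Exactness.IMHDelayedRejectionExact

/-!
# LatticeQCDFlow / Exactness — THE DELAYED-REJECTION FLOW KERNEL EXISTS, IS UNIQUE, AND DOES NOT CURE MODE COLLAPSE:
# a sector the flow under-covers is entered at most at TWICE the model's rate

HONEST FRAMING: exact (Metropolis-corrected) sampling algorithms for lattice gauge theory;
figures of merit are autocorrelation/cost numbers at stated couplings and volumes; no
continuum-physics claim.

Venture `LatticeQCDFlow` (cell pub-lqcd), topic `Exactness`, FANOUT row 30 (lean-1 GEN-43, theme SECOND CHANCES; companion of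
`IMHDelayedRejectionExact`, whose theorems quantify over "ANY kernel `K` realising the two-stage rule" — hypothesis `hK`).  NEW WORK of
the cell; no definition is introduced (the kernel is exhibited inside an existence proof from Mathlib's `Kernel.withDensity`,
`Kernel.const`, `Kernel.deterministic`, exactly as `IMHKernel.indepMH`), nothing is cited as a fact.  Printed counterpart of the
phenomenon in §3, NAMED ONLY: the mode-collapse ∕ topological-freezing discussion of flow samplers (Kanwar et al. 2020; Hackett et al.
2021; Abbott et al. 2023) — the tree's general-space entry bound is `IMHKernel.indepMH_apply_le_of_not_mem` (`K(x, B) ≤ q(B)`).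

## Results [all ours] (general measurable `Ω`; flow law `q`; weight `w > 0` measurable; `d`, `ã`, `m` as in `IMHDelayedRejectionExact`)

* **`dr_exists`**: there IS a Markov kernel realising the two-stage delayed-rejection rule (`hK` is not vacuous): the accept/reject
  kernel with landing density `ã(x, y) = a(x, y) + ∫ d(x, y₁, y) q(dy₁)` and stay mass `1 − ∫ ã(x, ·) dq`.
* **`dr_unique`**: any two kernels realising `hK` are EQUAL — the theorems of the series are about one well-defined sampler.
* `lintegral_drSecond_le_one`: the marginal second-stage density is at most one, `∫ d(x, y₁, y) q(dy₁) ≤ 1`; hence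
  **`dr_apply_le_two_mul_of_not_mem`**: from `x ∉ B`, `K(x, B) ≤ 2·q(B)` — a second flow draw at most DOUBLES the rate at which a
  sector of small MODEL mass is entered, whatever its target mass; and over `t` updates from any initial law `μ`,
  **`iterate_bind_dr_apply_le`**: `μKᵗ(B) ≤ μ(B) + 2t·q(B)` — filling a sector of target mass `π(B)` that the flow under-covers still
  takes `t ≥ (π(B) − μ(B))/(2 q(B))` updates.  Second chances buy acceptance, not coverage.
-/

namespace Summit.Ventures.LatticeQCDFlow.Exactness

open MeasureTheory ProbabilityTheory
open scoped ENNReal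

variable {Ω : Type*} [MeasurableSpace Ω] {q : Measure Ω} [IsProbabilityMeasure q] {w : Ω → ℝ}

/-! ## §1 Existence -/

/-- The total landing mass is at most one: `∫ ã(x, ·) dq = m(x) ≤ 1`. [ours, bookkeeping] -/
theorem lintegral_drDensity_le_one (hw : Measurable w) (hw0 : ∀ x, 0 < w x) (x : Ω) :
    ∫⁻ y, (imhAcceptE w x y +
        ∫⁻ y₁, ENNReal.ofReal (min (1 - imhAccept w x y₁) (w y * (1 - imhAccept w y y₁) / w x)) ∂q) ∂q ≤ 1 := by
  have ha : Measurable fun y => imhAcceptE w x y := (measurable_imhAcceptE hw).of_uncurry_left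
  rw [lintegral_add_left ha, ← lintegral_lintegral_drSecond_swap hw x]
  exact drMass_le_one hw hw0 x

/-- **THE DELAYED-REJECTION FLOW KERNEL EXISTS**: for every flow law `q` and positive measurable weight `w` there is a Markov kernel `K`
with `K(x, B) = ∫_B a(x, y) dq + ∫ (∫_B d(x, y₁, y₂) q(dy₂)) q(dy₁) + (1 − m(x))·1_B(x)` for all `x` and measurable `B`. [ours] -/
theorem dr_exists (hw : Measurable w) (hw0 : ∀ x, 0 < w x) :
    ∃ K : Kernel Ω Ω, IsMarkovKernel K ∧ ∀ (x : Ω) {B : Set Ω}, MeasurableSet B → K x B =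
      ∫⁻ y in B, imhAcceptE w x y ∂q +
        ∫⁻ y₁, ∫⁻ y₂ in B, ENNReal.ofReal (min (1 - imhAccept w x y₁) (w y₂ * (1 - imhAccept w y₂ y₁) / w x)) ∂q ∂q +
        (1 - (imhAcceptMass q w x +
          ∫⁻ y₁, ∫⁻ y₂, ENNReal.ofReal (min (1 - imhAccept w x y₁) (w y₂ * (1 - imhAccept w y₂ y₁) / w x)) ∂q ∂q)) *
          B.indicator 1 x := by
  -- the landing density and the stay mass
  set dens : Ω → Ω → ℝ≥0∞ := fun x y => imhAcceptE w x y +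
    ∫⁻ y₁, ENNReal.ofReal (min (1 - imhAccept w x y₁) (w y * (1 - imhAccept w y y₁) / w x)) ∂q with hdens
  have hdens_m : Measurable (Function.uncurry dens) := measurable_drDensity q hw
  have hmass : Measurable fun x => ∫⁻ y, dens x y ∂q := hdens_m.lintegral_prod_right'
  have h2 : Measurable (Function.uncurry fun (x : Ω) (_ : Ω) => 1 - ∫⁻ y, dens x y ∂q) :=
    measurable_const.sub (hmass.comp measurable_fst)
  let K : Kernel Ω Ω := Kernel.withDensity (Kernel.const Ω q) dens +
    Kernel.withDensity (Kernel.deterministic id measurable_id) (fun x _ => 1 - ∫⁻ y, dens x y ∂q)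
  have hKapply : ∀ (x : Ω) {B : Set Ω}, MeasurableSet B →
      K x B = ∫⁻ y in B, dens x y ∂q + (1 - ∫⁻ y, dens x y ∂q) * B.indicator 1 x := by
    intro x B hB
    simp only [K]
    rw [Kernel.add_apply, Measure.add_apply, Kernel.withDensity_apply' _ hdens_m, Kernel.const_apply,
      Kernel.withDensity_apply' _ h2, Kernel.deterministic_apply, setLIntegral_const, id, Measure.dirac_apply' x hB]
  have hKtwo : ∀ (x : Ω) {B : Set Ω}, MeasurableSet B → K x B =
      ∫⁻ y in B, imhAcceptE w x y ∂q +
        ∫⁻ y₁, ∫⁻ y₂ in B, ENNReal.ofReal (min (1 - imhAccept w x y₁) (w y₂ * (1 - imhAccept w y₂ y₁) / w x)) ∂q ∂q +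
        (1 - (imhAcceptMass q w x +
          ∫⁻ y₁, ∫⁻ y₂, ENNReal.ofReal (min (1 - imhAccept w x y₁) (w y₂ * (1 - imhAccept w y₂ y₁) / w x)) ∂q ∂q)) *
          B.indicator 1 x := by
    intro x B hB
    have ha : Measurable fun y => imhAcceptE w x y := (measurable_imhAcceptE hw).of_uncurry_left
    rw [hKapply x hB, hdens]
    simp only
    rw [lintegral_add_left ha, lintegral_add_left ha, lintegral_setLIntegral_drSecond_swap hw x B,
      lintegral_lintegral_drSecond_swap hw x]
    rfl
  refine ⟨K, ⟨fun x => ⟨?_⟩⟩, hKtwo⟩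
  rw [hKapply x MeasurableSet.univ, Measure.restrict_univ, Set.indicator_univ, Pi.one_apply, mul_one]
  exact add_tsub_cancel_of_le (lintegral_drDensity_le_one hw hw0 x)

/-! ## §2 Uniqueness -/

omit [IsProbabilityMeasure q] in
/-- **… AND IS UNIQUE**: two kernels realising the two-stage rule coincide. [ours] -/
theorem dr_unique (K K' : Kernel Ω Ω)
    (hK : ∀ (x : Ω) {B : Set Ω}, MeasurableSet B → K x B =
      ∫⁻ y in B, imhAcceptE w x y ∂q +
        ∫⁻ y₁, ∫⁻ y₂ in B, ENNReal.ofReal (min (1 - imhAccept w x y₁) (w y₂ * (1 - imhAccept w y₂ y₁) / w x)) ∂q ∂q +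
        (1 - (imhAcceptMass q w x +
          ∫⁻ y₁, ∫⁻ y₂, ENNReal.ofReal (min (1 - imhAccept w x y₁) (w y₂ * (1 - imhAccept w y₂ y₁) / w x)) ∂q ∂q)) *
          B.indicator 1 x)
    (hK' : ∀ (x : Ω) {B : Set Ω}, MeasurableSet B → K' x B =
      ∫⁻ y in B, imhAcceptE w x y ∂q +
        ∫⁻ y₁, ∫⁻ y₂ in B, ENNReal.ofReal (min (1 - imhAccept w x y₁) (w y₂ * (1 - imhAccept w y₂ y₁) / w x)) ∂q ∂q +
        (1 - (imhAcceptMass q w x +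
          ∫⁻ y₁, ∫⁻ y₂, ENNReal.ofReal (min (1 - imhAccept w x y₁) (w y₂ * (1 - imhAccept w y₂ y₁) / w x)) ∂q ∂q)) *
          B.indicator 1 x) :
    K = K' :=
  Kernel.ext_iff'.2 fun x B hB => by rw [hK x hB, hK' x hB]

/-! ## §3 Second chances do not cure mode collapse -/

/-- **The marginal second-stage density is at most one**: `∫ d(x, y₁, y) q(dy₁) ≤ ∫ (1 − a(x, y₁)) q(dy₁) ≤ 1`. [ours] -/
theorem lintegral_drSecond_le_one (hw0 : ∀ x, 0 < w x) (x y : Ω) :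
    ∫⁻ y₁, ENNReal.ofReal (min (1 - imhAccept w x y₁) (w y * (1 - imhAccept w y y₁) / w x)) ∂q ≤ 1 :=
  calc ∫⁻ y₁, ENNReal.ofReal (min (1 - imhAccept w x y₁) (w y * (1 - imhAccept w y y₁) / w x)) ∂q
      ≤ ∫⁻ y₁, (1 - imhAcceptE w x y₁) ∂q := lintegral_mono fun y₁ => drSecond_le_one_sub hw0 x y₁ y
    _ ≤ ∫⁻ _, 1 ∂q := lintegral_mono fun _ => tsub_le_self
    _ = 1 := by rw [lintegral_const, measure_univ, mul_one]

/-- **THE SECTOR-ENTRY BOUND FOR DELAYED REJECTION**: from any `x ∉ B`, `K(x, B) ≤ 2·q(B)` — whatever the target mass of `B`, a sector of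
small MODEL mass is entered at most at twice the model's rate (`indepMH`: at most `q(B)`). [ours] -/
theorem dr_apply_le_two_mul_of_not_mem (hw : Measurable w) (hw0 : ∀ x, 0 < w x) (K : Kernel Ω Ω)
    (hK : ∀ (x : Ω) {B : Set Ω}, MeasurableSet B → K x B =
      ∫⁻ y in B, imhAcceptE w x y ∂q +
        ∫⁻ y₁, ∫⁻ y₂ in B, ENNReal.ofReal (min (1 - imhAccept w x y₁) (w y₂ * (1 - imhAccept w y₂ y₁) / w x)) ∂q ∂q +
        (1 - (imhAcceptMass q w x +
          ∫⁻ y₁, ∫⁻ y₂, ENNReal.ofReal (min (1 - imhAccept w x y₁) (w y₂ * (1 - imhAccept w y₂ y₁) / w x)) ∂q ∂q)) *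
          B.indicator 1 x)
    {x : Ω} {B : Set Ω} (hB : MeasurableSet B) (hx : x ∉ B) : K x B ≤ 2 * q B := by
  rw [hK x hB, Set.indicator_of_notMem hx, mul_zero, add_zero, lintegral_setLIntegral_drSecond_swap hw x B, two_mul]
  refine add_le_add ?_ ?_
  · calc ∫⁻ y in B, imhAcceptE w x y ∂q ≤ ∫⁻ _ in B, 1 ∂q := lintegral_mono fun y => imhAcceptE_le_one w x y
      _ = q B := by rw [setLIntegral_const, one_mul]
  · calc ∫⁻ y in B, ∫⁻ y₁, ENNReal.ofReal (min (1 - imhAccept w x y₁) (w y * (1 - imhAccept w y y₁) / w x)) ∂q ∂q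
        ≤ ∫⁻ _ in B, 1 ∂q := lintegral_mono fun y => lintegral_drSecond_le_one hw0 x y
      _ = q B := by rw [setLIntegral_const, one_mul]

/-- One delayed-rejection update raises the mass of `B` by at most `2·q(B)`: `(μK)(B) ≤ μ(B) + 2·q(B)`. [ours] -/
theorem bind_dr_apply_le (hw : Measurable w) (hw0 : ∀ x, 0 < w x) (K : Kernel Ω Ω) [IsMarkovKernel K]
    (hK : ∀ (x : Ω) {B : Set Ω}, MeasurableSet B → K x B =
      ∫⁻ y in B, imhAcceptE w x y ∂q +
        ∫⁻ y₁, ∫⁻ y₂ in B, ENNReal.ofReal (min (1 - imhAccept w x y₁) (w y₂ * (1 - imhAccept w y₂ y₁) / w x)) ∂q ∂q +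
        (1 - (imhAcceptMass q w x +
          ∫⁻ y₁, ∫⁻ y₂, ENNReal.ofReal (min (1 - imhAccept w x y₁) (w y₂ * (1 - imhAccept w y₂ y₁) / w x)) ∂q ∂q)) *
          B.indicator 1 x)
    (μ : Measure Ω) [IsProbabilityMeasure μ] {B : Set Ω} (hB : MeasurableSet B) :
    (μ.bind K) B ≤ μ B + 2 * q B := by
  rw [Measure.bind_apply hB (Kernel.aemeasurable _), ← lintegral_add_compl _ hB]
  have h1 : ∫⁻ x in B, K x B ∂μ ≤ μ B :=
    calc ∫⁻ x in B, K x B ∂μ ≤ ∫⁻ _ in B, 1 ∂μ := lintegral_mono fun x => prob_le_one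
      _ = μ B := by rw [setLIntegral_const, one_mul]
  have h2 : ∫⁻ x in Bᶜ, K x B ∂μ ≤ 2 * q B :=
    calc ∫⁻ x in Bᶜ, K x B ∂μ ≤ ∫⁻ _ in Bᶜ, 2 * q B ∂μ :=
          setLIntegral_mono' hB.compl fun x hx => dr_apply_le_two_mul_of_not_mem hw hw0 K hK hB hx
      _ = 2 * q B * μ Bᶜ := setLIntegral_const _ _
      _ ≤ 2 * q B * 1 := mul_le_mul' le_rfl prob_le_one
      _ = 2 * q B := mul_one _
  exact add_le_add h1 h2

/-- **FILLING AN UNDER-COVERED SECTOR STILL TAKES `(π(B) − μ(B))/(2q(B))` UPDATES**: after `t` delayed-rejection updates from any initial law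
`μ`, `μKᵗ(B) ≤ μ(B) + 2t·q(B)`. [ours] -/
theorem iterate_bind_dr_apply_le (hw : Measurable w) (hw0 : ∀ x, 0 < w x) (K : Kernel Ω Ω) [IsMarkovKernel K]
    (hK : ∀ (x : Ω) {B : Set Ω}, MeasurableSet B → K x B =
      ∫⁻ y in B, imhAcceptE w x y ∂q +
        ∫⁻ y₁, ∫⁻ y₂ in B, ENNReal.ofReal (min (1 - imhAccept w x y₁) (w y₂ * (1 - imhAccept w y₂ y₁) / w x)) ∂q ∂q +
        (1 - (imhAcceptMass q w x +
          ∫⁻ y₁, ∫⁻ y₂, ENNReal.ofReal (min (1 - imhAccept w x y₁) (w y₂ * (1 - imhAccept w y₂ y₁) / w x)) ∂q ∂q)) *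
          B.indicator 1 x)
    {B : Set Ω} (hB : MeasurableSet B) :
    ∀ (t : ℕ) (μ : Measure Ω) [IsProbabilityMeasure μ],
      ((fun ν : Measure Ω => ν.bind K)^[t] μ) B ≤ μ B + 2 * t * q B
  | 0, μ, _ => by simp
  | t + 1, μ, _ => by
    rw [Function.iterate_succ_apply]
    calc ((fun ν : Measure Ω => ν.bind K)^[t] (μ.bind K)) B
          ≤ (μ.bind K) B + 2 * t * q B := iterate_bind_dr_apply_le hw hw0 K hK hB t _
      _ ≤ μ B + 2 * q B + 2 * t * q B := add_le_add (bind_dr_apply_le hw hw0 K hK μ hB) le_rfl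
      _ = μ B + 2 * (t + 1 : ℕ) * q B := by push_cast; ring

end Summit.Ventures.LatticeQCDFlow.Exactness
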